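import Mathlib
import Literature.MathematicalPhysics.QuantumFieldTheory.YangMillsOS
import Literature.MathematicalPhysics.QuantumFieldTheory.WilsonTransferKernel
import HarnessLib

/-!
# Route `BalabanLadder`, crux `IR` (stmt-QuantumFields-19354): vocabulary of the FLUX-CODE BLINDNESS reduction

Route-posited objects (D-0016 `<Route><Crux>Defs` file) of the crux-idea card
`Summits/QuantumFields/YangMills/Cruxes/IR/Ideas/ym19354-5-flux-code-blindness.md` (seat `ym-cruxidea-19354-5`, gen 3;
sketch of record `Sketch-g3.lean` rev 3, sha16 `c463f541daed4b01`, evidence #48 on stmt-QuantumFields-19354), landed as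
helper modules at the route owner's ruling R34 (ym-beyond-p2 g25, 2026-08-27): «the sorry-free reduction
`IR_of_lightCodePincer : LightCodePincerInputs → …BalabanLadder.IR` may land as helper modules, `--supports
stmt-QuantumFields-19354`; split `CodeTrace` ∕ pincer; no local copies of tree defs».  This module holds ONLY the
definitions; the proofs live in `BalabanLadderIRLightCodeFrame` (frame ∕ residual ∕ trace algebra),
`BalabanLadderIRLightCodeTraceCluster` (the `q`-level trace clustering), `BalabanLadderIRLightCodePincer` (lattice seams
and `IR_of_lightCodePincer`) and `BalabanLadderIRLightCodeBlindness` (abstract blindness ∕ necessity ∕ W-currency lemmas).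

CONTENT (card §Mechanism).  The transfer-matrix (reflection-positivity) reading of the infrared leg `GapInUnits` at
`π₁(G) ≠ 1` is a statement about a LIGHT SPECTRAL SUBSPACE of dimension `q + 1 ≤ |π₁(G)|³` (vacuum + flux vacua):
uniform exponential clustering of the periodic torus state holds (modulo bookkeeping) iff
* SECTOR-RESOLVED COLD PRESSURE — the thermal trace ABOVE the light multiplet is cold:
  `tr T^m − Σ_{k ≤ q} θ_k^m ≤ C₀ V e^{−μ m}` (Wilson's bet per flux sector; `q = 0` is the landed cold-pressure clause (ii) of
  `Theorems.WeakCouplingHypercubicLimit.TraceNormColdPressure.abs_latticeConnectedCorr_le_of_coldPressure`), and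
* the light multiplet is a CODE for local observables (Knill–Laflamme shape): on the light frame every block observable is
  `⟨Ω, A Ω⟩ · θ_k^w` on the diagonal and `0` off it, up to `εc ≤ e^{−μ S}` — the flux vacua are locally indistinguishable
  and local observables neither create nor destroy global flux.

* §1 finite LIGHT-CODE TRANSFER MODELS on `ℝ^d` (the level of the tree's `stub_transferRepresentation` ∕ `stub_traceCluster`):
  `Euc`, the trace `tr'`, `modelCorr` (the normalised connected transfer trace — verbatim the expression of
  `stub_transferRepresentation`), `secExcess` (SECTOR-RESOLVED trace excess), `LightCodeModel`.
* §2 the `CodeTrace` engine's operators: frame projection `frameProj`, weighted frame operator `framePow`, residual `resid`.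
* §3 lattice level: the per-`β` certificate `LightCodeCertificateAt r β Q μ wd` and the order-free W-currency
  `LightMultipletPressureAt r β Q μ` (cold pressure MODULO a light multiplet; `Q = 0` ⟺ the landed clause).  The
  hypothesis bundle `LightCodePincerInputs` of the composition `IR_of_lightCodePincer` lives in
  `BalabanLadderIRLightCodePincerDefs` (it needs the `DlrCollarTransfer` vocabulary `Q2` of the crux `IR`, i.e. the
  cone of route file `LangevinControlUV`; this module stays route-independent: Mathlib + Literature imports only).

NOTHING here is asserted and nothing is a literature fact: every `def … : Prop` is a line statement that the proof
modules consume or relate (the producers of the certificate at weak coupling — coarse flux-sector quasi-conservation,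
sector-mean blindness of the cover's twisted free energy, sector cold pressure — are NOT typed; card §What it needs).
HONEST FRAMING: vocabulary of a conditional reduction inside a conditional chain; not a gap claim.

Refs: card `ym19354-5-flux-code-blindness` (tree); 't Hooft, Nucl. Phys. B153 (1979) (flux sectors, twisted partition
functions); Greensite, *An Introduction to the Confinement Problem* (2011) (4.47); Knill–Laflamme, Phys. Rev. A 55 (1997)
(code condition — the SHAPE only); Osterwalder–Seiler, Ann. Phys. 110 (1978) §§2–3 (transfer matrix, `traceExcess`,
`latticeConnectedCorr`); the `q = 0` twins `Theorems/PencilRigidityWeakCouplingHypercubicLimit{StubTraceCluster,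
ColdPressureClustering}.lean`.
-/

set_option autoImplicit false

noncomputable section

open scoped BigOperators InnerProductSpace
open InnerProductSpace
open Literature.MathematicalPhysics.QuantumFieldTheory Literature.MathematicalPhysics.QuantumLattice

namespace Summit.QuantumFields.YangMills.Cruxes.IR.FluxCodeBlindness

/-! ## §1 Finite light-code transfer models -/

/-- The model state space `ℝ^d` with its Euclidean inner product (the tree's transfer representations are anonymous
finite models on `EuclideanSpace ℝ (Fin d)`, cf. `stub_transferRepresentation`). -/
abbrev Euc (d : ℕ) : Type := EuclideanSpace ℝ (Fin d)

/-- Trace of a continuous linear endomorphism of a real inner product space (as a linear map; used on the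
finite-dimensional models `Euc d`, where it is the matrix trace). -/
def tr' {E : Type*} [NormedAddCommGroup E] [InnerProductSpace ℝ E] (M : E →L[ℝ] E) : ℝ :=
  LinearMap.trace ℝ E (M : E →ₗ[ℝ] E)

/-- The normalised connected transfer trace of a model `(T, Ao, Bo)` for torus period `2S+1`, separation `n`, block
width `w`: `tr(T^{2S+1−n−w} A T^{n−w} B)/tr T^{2S+1} − (tr(T^{2S+1−w} A)/tr T^{2S+1})·(tr(T^{2S+1−w} B)/tr T^{2S+1})` —
verbatim the expression of the tree's `stub_transferRepresentation` (ℕ-subtraction in the exponents is harmless: the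
consumers assume `w < n ≤ S`, `2w ≤ S`). -/
def modelCorr {d : ℕ} (T Ao Bo : Euc d →L[ℝ] Euc d) (S n w : ℕ) : ℝ :=
  tr' (T ^ (2 * S + 1 - n - w) * Ao * T ^ (n - w) * Bo) / tr' (T ^ (2 * S + 1)) -
    tr' (T ^ (2 * S + 1 - w) * Ao) / tr' (T ^ (2 * S + 1)) *
      (tr' (T ^ (2 * S + 1 - w) * Bo) / tr' (T ^ (2 * S + 1)))

/-- SECTOR-RESOLVED trace excess of a model above a light frame with eigenvalues `θ`: `tr T^m − Σ_k θ_k^m`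
(for `q = 0`, `θ 0 = 1` this is the landed `tr T^m − 1`, see `secExcess_rank_zero`). -/
def secExcess {d q : ℕ} (T : Euc d →L[ℝ] Euc d) (θ : Fin (q + 1) → ℝ) (m : ℕ) : ℝ :=
  tr' (T ^ m) - ∑ k : Fin (q + 1), θ k ^ m

/-- **Light-code model.**  `T` positive; `e` an orthonormal LIGHT FRAME of `q+1` eigenvectors (`e 0` = the vacuum,
`θ 0 = 1`, all `θ_k ∈ [0,1]`); contraction by `ρ` on the orthocomplement of the frame; and the CODE bounds: on the frame
each block observable is `⟨e 0, A e 0⟩ · θ_k^w` on the diagonal and `0` off it, up to `εc` (Knill–Laflamme shape). -/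
def LightCodeModel {d q : ℕ} (T Ao Bo : Euc d →L[ℝ] Euc d) (e : Fin (q + 1) → Euc d) (θ : Fin (q + 1) → ℝ)
    (ρ εc : ℝ) (w : ℕ) : Prop :=
  T.IsPositive ∧ Orthonormal ℝ e ∧ (∀ k, T (e k) = θ k • e k) ∧ θ 0 = 1 ∧ (∀ k, 0 ≤ θ k ∧ θ k ≤ 1) ∧
    (∀ v : Euc d, (∀ k, inner ℝ (e k) v = 0) → ‖T v‖ ≤ ρ * ‖v‖) ∧
    (∀ k l, |inner ℝ (e k) (Ao (e l)) - (if k = l then inner ℝ (e 0) (Ao (e 0)) * θ k ^ w else 0)| ≤ εc) ∧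
    (∀ k l, |inner ℝ (e k) (Bo (e l)) - (if k = l then inner ℝ (e 0) (Bo (e 0)) * θ k ^ w else 0)| ≤ εc)

/-! ## §2 The `CodeTrace` engine's operators (finite-dimensional linear algebra) -/

namespace CodeTrace

variable {E : Type*} [NormedAddCommGroup E] [InnerProductSpace ℝ E] {q : ℕ}

/-- Frame projection `P = Σ_k |e_k⟩⟨e_k|` of a finite frame `e`. -/
def frameProj (e : Fin (q + 1) → E) : E →L[ℝ] E := ∑ k, (rankOne ℝ (e k) (e k) : E →L[ℝ] E)

/-- Weighted frame operator `P_m = Σ_k θ_k^m |e_k⟩⟨e_k|` (the light multiplet's free propagation for `m` steps). -/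
def framePow (e : Fin (q + 1) → E) (θ : Fin (q + 1) → ℝ) (m : ℕ) : E →L[ℝ] E :=
  ∑ k, θ k ^ m • (rankOne ℝ (e k) (e k) : E →L[ℝ] E)

/-- The residual `R_m = T^m − P_m` of the transfer power off the light frame (positive, of norm `≤ ρ^m`, with
`tr R_m = secExcess` — `BalabanLadderIRLightCodeFrame`). -/
def resid (T : E →L[ℝ] E) (e : Fin (q + 1) → E) (θ : Fin (q + 1) → ℝ) (m : ℕ) : E →L[ℝ] E :=
  T ^ m - framePow e θ m

end CodeTrace

/-! ## §3 Lattice level: the certificate and the W-currency -/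

section Lattice

variable {G : Type} [Group G] [TopologicalSpace G] [IsTopologicalGroup G] [CompactSpace G]
  [MeasurableSpace G] [BorelSpace G]

/-- **Light-code certificate at coupling `β`** with light rank `≤ Q`, rate `μ` (lattice units) and width map `wd`
(the block width of the transfer representation of a species pair — β-INDEPENDENT, as in `stub_transferRepresentation`):
a size threshold `L` and a sector cold-pressure constant `C₀`, uniform in the species, beyond which every bounded species
pair is `δ`-represented (every `δ > 0`) by a light-code model with contraction `e^{−μ}`, code error `e^{−μ S}` and sector
trace excesses `≤ C₀ (2S+1)³ e^{−μ m}` in the cold range `S + 1 ≤ 2m`. -/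
def LightCodeCertificateAt (r : LatticeRep G) (β : ℝ) (Q : ℕ) (μ : ℝ)
    (wd : YMSpecies G → YMSpecies G → ℕ) : Prop :=
  ∃ C₀ : ℝ, 0 ≤ C₀ ∧ ∃ L : ℕ, ∀ (A B : YMSpecies G) (CA CB : ℝ), (∀ U, |A.F U| ≤ CA) → (∀ U, |B.F U| ≤ CB) →
    ∀ S n : ℕ, L ≤ S → n ≤ S → wd A B < n → 2 * wd A B ≤ S → ∀ δ : ℝ, 0 < δ →
      ∃ (d q : ℕ) (T Ao Bo : Euc d →L[ℝ] Euc d) (e : Fin (q + 1) → Euc d) (θ : Fin (q + 1) → ℝ),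
        q ≤ Q ∧ LightCodeModel T Ao Bo e θ (Real.exp (-μ)) (Real.exp (-(μ * S))) (wd A B) ∧ ‖Ao‖ ≤ CA ∧ ‖Bo‖ ≤ CB ∧
        (∀ m : ℕ, S + 1 ≤ 2 * m → secExcess T θ m ≤ C₀ * ((2 * S + 1 : ℕ) : ℝ) ^ 3 * Real.exp (-(μ * m))) ∧
        |latticeConnectedCorr r.ρ β (2 * S + 1) A.F B.F n - modelCorr T Ao Bo S n (wd A B)| ≤ δ

/-- **Cold pressure modulo a light multiplet of rank `Q`** at coupling `β`, rate `μ` — the order-free, species-free,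
boundary-free (W)-currency in terms of the landed `traceExcess` ('t Hooft's picture of the cold periodic torus at
`π₁(G) ≠ 1`: `Z_β(m × (2S+1)³)/λ₊^m = 1 + Σ_{k<Q} θ_k^m + O(C₀ (2S+1)³ e^{−μ m})`): for `S ≥ L` there are `Q` numbers
`θ_k ∈ [0,1]` (the light levels of the `(2S+1)³` torus, vacuum excluded) such that for all cold extents `m+2 ≥ (S+1)/2`
the trace excess minus the light multiplet is `≤ C₀ (2S+1)³ e^{−μ (m+2)}`.  `Q = 0` is VERBATIM the cold-pressure clause
(`lightMultipletPressureAt_zero_iff` in `BalabanLadderIRLightCodeBlindness`). -/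
def LightMultipletPressureAt (r : LatticeRep G) (β : ℝ) (Q : ℕ) (μ : ℝ) : Prop :=
  ∃ C₀ : ℝ, 0 ≤ C₀ ∧ ∃ L : ℕ, ∀ S : ℕ, L ≤ S →
    ∃ θ : Fin Q → ℝ, (∀ k, 0 ≤ θ k ∧ θ k ≤ 1) ∧
      ∀ m : ℕ, S + 1 ≤ 2 * (m + 2) →
        traceExcess r.ρ β (2 * S + 1) (m + 2) - ∑ k, θ k ^ (m + 2) ≤
          C₀ * ((2 * S + 1 : ℕ) : ℝ) ^ 3 * Real.exp (-(μ * ((m + 2 : ℕ) : ℝ)))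

end Lattice

end Summit.QuantumFields.YangMills.Cruxes.IR.FluxCodeBlindness

end
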